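import Literature.Analysis.ODE.HeunEulerKernel
import Literature.Geometry.Lorentzian.KerrDeSitterThresholdRays
import HarnessLib

/-!
# Kerr–de Sitter: the Euler kernel behind Casals–Teixeira da Costa's hidden symmetry `m₂ ↔ m₃`
# (their Lemma 3.5 masses, eq. (3.11), Corollary 3.9/3.10 (iii) eq. (3.25)) — exact algebra

Source: M. Casals, R. Teixeira da Costa, *Hidden spectral symmetries and mode stability of
subextremal Kerr(-de Sitter) black holes*, Commun. Math. Phys. 394 (2022) 797–832
[CasalsTeixeiradacosta2022], arXiv:2105.13329, §3.3: the radial Teukolsky ODE in the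
"SQCD" normal form (3.11) `z(z−1)(z−z₂) y″ + C(z) y = 0` with masses (3.15)
`m₁ = s−η₁−η₀, m₂ = η₀−η₁, m₃ = −s−η₁−η₀, m₄ = η₀+η₁+2η₂` (`η_j` of (3.10): the tree's
`etaCauchy`, `etaEvent`, `etaCosmo`), and the statement (Prop. 3.8/3.9, Cor. 3.9/3.10) that the
point spectrum is invariant under `m₂ ↔ m₃`, the swapped problem being the ODE (3.25) with boundary
conditions (3.26). The printed proof goes through hypergeometric-polynomial expansions and a
continued fraction.

What this file PROVES (pure algebra, every statement an identity of rational functions):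
* `sqcdCoeff_eq_normalForm`: (3.11) is EXACTLY the normal form (first-derivative term removed by
  `y = z^{γ/2}(z−1)^{δ/2}(z−z₂)^{ε/2} g`) of the general Heun equation
  `GeneralHeun.lead·g″ + GeneralHeun.mid γ δ ε·g′ + GeneralHeun.low α β q·g = 0` in the gauge
  `(γ,δ,ε) = (1−m₁+m₂, 1+m₁+m₂, 1−m₃−m₄)`, `α = 1+m₂−m₃`, `β = 1+m₂−m₄`, accessory parameter
  `eulerGaugeQ` (Umetsu's sign);
* `euler_swap_γ/δ/ε/α/β/q`: Takemura's Euler-transformation parameter map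
  (`GeneralHeun.eulerSrc*`, [Takemura2017] Prop. 1.2) with exponent `η = α = 1+m₂−m₃` sends these
  six parameters EXACTLY to the same expressions with `m₂ ↔ m₃` — i.e. the hidden symmetry
  `m₂ ↔ m₃` IS Euler's integral transformation `y ↦ ∫ y(w)(z−w)^{−(1+m₂−m₃)}dw` at the level of the
  ODE (the solution-level statement needs analysis and is NOT claimed here);
* `pairSum_*`, `eulerGauge*_eta`: the masses' pair sums are the quantities in the hypotheses of the
  tree's named fact `CasalsTeixeiraDaCosta2022_partialModeStabilityProp38` (`s−2η₁`, `−s+2η₂`,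
  `−2(η₁+η₀)`, `2(η₀+η₂)`), and the Euler exponent is `θ = 1 + s + 2η₀`;
* `branch_event`, `branch_cosmo` (+ swapped): in this gauge the generic in/outgoing conditions
  (3.16)/(3.26) select the branch `(z−1)^{1−δ}` at the event horizon `z = 1` and the ANALYTIC branch
  at the cosmological horizon `z = z₂`, before and after the swap;
* `ctdcTilde_eq_sqcd_swap`: the `y`-coefficient of CTdC's (3.25) is, symbol for symbol, that of
  (3.11) with `m₂ ↔ m₃` and (3.15) substituted (masses, `E z₂` of (3.15b), `z₂, z_∞` of (3.14),
  `r₃ = −(r₀+r₁+r₂)`), the `λ̄`-block being one free symbol.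
NOT here: Lemma 3.5 itself (radial ODE (3.8) → (3.11)), anything about solutions. No named facts.
Exact computer-algebra companions: pub-kds kit jobs j165017, j165077, j165108 (sympy).

## References
* Casals–Teixeira da Costa, arXiv:2105.13329, Lemma 3.5, (3.11), (3.14)–(3.16), Notation 3.8,
  Cor. 3.10 with (3.25)–(3.26) (arXiv v1 numbering; = v3 Prop. 3.8/Cor. 3.9). Key
  `CasalsTeixeiradacosta2022`.
* K. Takemura, J. Math. Soc. Japan 69 (2017) 849–891, Prop. 1.2. Key `Takemura2017`.
-/

noncomputable section

open Complex

namespace Literature.Geometry.Lorentzian.KerrDeSitter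

open Literature.Analysis.ODE

/-! ### The masses (3.15a) and their pair sums -/

/-- `m₁ = s − η₁ − η₀`. [cite: CasalsTeixeiradacosta2022, Lemma 3.5 (3.15)] -/
def sqcdM₁ (s η₀ η₁ : ℂ) : ℂ := s - η₁ - η₀

/-- `m₂ = η₀ − η₁`. [cite: CasalsTeixeiradacosta2022, Lemma 3.5 (3.15)] -/
def sqcdM₂ (η₀ η₁ : ℂ) : ℂ := η₀ - η₁

/-- `m₃ = −s − η₁ − η₀`. [cite: CasalsTeixeiradacosta2022, Lemma 3.5 (3.15)] -/
def sqcdM₃ (s η₀ η₁ : ℂ) : ℂ := -s - η₁ - η₀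

/-- `m₄ = η₀ + η₁ + 2η₂`. [cite: CasalsTeixeiradacosta2022, Lemma 3.5 (3.15)] -/
def sqcdM₄ (η₀ η₁ η₂ : ℂ) : ℂ := η₀ + η₁ + 2 * η₂

/-- `m₁ + m₂ = s − 2η₁` (the first pair sum in Prop. 3.8's hypotheses).
[cite: CasalsTeixeiradacosta2022, Lemma 3.5 and proof of Corollary 3.9] -/
theorem pairSum₁₂ (s η₀ η₁ : ℂ) : sqcdM₁ s η₀ η₁ + sqcdM₂ η₀ η₁ = s - 2 * η₁ := by
  unfold sqcdM₁ sqcdM₂; ring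

/-- `m₃ + m₄ = −s + 2η₂`. [cite: CasalsTeixeiradacosta2022, Lemma 3.5 and proof of Corollary 3.9] -/
theorem pairSum₃₄ (s η₀ η₁ η₂ : ℂ) : sqcdM₃ s η₀ η₁ + sqcdM₄ η₀ η₁ η₂ = -s + 2 * η₂ := by
  unfold sqcdM₃ sqcdM₄; ring

/-- `m₁ + m₃ = −2(η₁ + η₀)`. [cite: CasalsTeixeiradacosta2022, Lemma 3.5 and proof of Corollary 3.9] -/
theorem pairSum₁₃ (s η₀ η₁ : ℂ) : sqcdM₁ s η₀ η₁ + sqcdM₃ s η₀ η₁ = -2 * (η₁ + η₀) := by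
  unfold sqcdM₁ sqcdM₃; ring

/-- `m₂ + m₄ = 2(η₀ + η₂)`. [cite: CasalsTeixeiradacosta2022, Lemma 3.5 and proof of Corollary 3.9] -/
theorem pairSum₂₄ (η₀ η₁ η₂ : ℂ) : sqcdM₂ η₀ η₁ + sqcdM₄ η₀ η₁ η₂ = 2 * (η₀ + η₂) := by
  unfold sqcdM₂ sqcdM₄; ring

/-- `Σ m_j = 2(η₂ − η₁)`. [cite: CasalsTeixeiradacosta2022, proof of Corollary 3.9] -/
theorem massSum (s η₀ η₁ η₂ : ℂ) :
    sqcdM₁ s η₀ η₁ + sqcdM₂ η₀ η₁ + sqcdM₃ s η₀ η₁ + sqcdM₄ η₀ η₁ η₂ = 2 * (η₂ - η₁) := by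
  unfold sqcdM₁ sqcdM₂ sqcdM₃ sqcdM₄; ring

/-! ### Eq. (3.11) and its Heun gauge -/

/-- The `y`-coefficient `C(z)` of CTdC's (3.11), `z(z−1)(z−z₂) y″ + C(z) y = 0`:
`C = ((4E−1)z₂+1)/4 − [¼ z(z−1)((m₃+m₄)²−1) − m₃m₄(z−z₂)(z−½)]/(z−z₂)`
`    − [m₁m₂(z/2−z₂)(z−1) + ¼(z−z₂)((m₁+m₂)²−1)]/(z(z−1))`.
[cite: CasalsTeixeiradacosta2022, (3.11)] -/
def sqcdCoeff (m₁ m₂ m₃ m₄ E z₂ : ℂ) (z : ℝ) : ℂ :=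
  ((4 * E - 1) * z₂ + 1) / 4
    - ((1 / 4 : ℂ) * z * ((z : ℂ) - 1) * ((m₃ + m₄) ^ 2 - 1)
        - m₃ * m₄ * ((z : ℂ) - z₂) * ((z : ℂ) - 1 / 2)) / ((z : ℂ) - z₂)
    - (m₁ * m₂ * ((z : ℂ) / 2 - z₂) * ((z : ℂ) - 1)
        + (1 / 4 : ℂ) * ((z : ℂ) - z₂) * ((m₁ + m₂) ^ 2 - 1)) / ((z : ℂ) * ((z : ℂ) - 1))

/-- Euler gauge: `γ = 1 − m₁ + m₂`. [cite: CasalsTeixeiradacosta2022, (3.11) with Takemura2017 Prop. 1.2] -/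
def eulerGaugeγ (m₁ m₂ : ℂ) : ℂ := 1 - m₁ + m₂

/-- Euler gauge: `δ = 1 + m₁ + m₂`. [cite: CasalsTeixeiradacosta2022, (3.11) with Takemura2017 Prop. 1.2] -/
def eulerGaugeδ (m₁ m₂ : ℂ) : ℂ := 1 + m₁ + m₂

/-- Euler gauge: `ε = 1 − m₃ − m₄`. [cite: CasalsTeixeiradacosta2022, (3.11) with Takemura2017 Prop. 1.2] -/
def eulerGaugeε (m₃ m₄ : ℂ) : ℂ := 1 - m₃ - m₄

/-- Euler gauge: `α = 1 + m₂ − m₃` — this is also the Euler exponent `η`.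
[cite: CasalsTeixeiradacosta2022, (3.11) with Takemura2017 Prop. 1.2] -/
def eulerGaugeα (m₂ m₃ : ℂ) : ℂ := 1 + m₂ - m₃

/-- Euler gauge: `β = 1 + m₂ − m₄`. [cite: CasalsTeixeiradacosta2022, (3.11) with Takemura2017 Prop. 1.2] -/
def eulerGaugeβ (m₂ m₄ : ℂ) : ℂ := 1 + m₂ - m₄

/-- Euler gauge: the accessory parameter in Umetsu's sign convention (`low = αβ z + q`):
`q = (4Ez₂ − z₂ − 1 − 4m₂(m₂+1)z₂ + 2(m₁+m₃+m₄) − 2m₂ + 2m₁m₂ − 2m₁m₃ − 2m₁m₄ + 2m₂m₃ + 2m₂m₄ − 2m₃m₄)/4`.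
[cite: CasalsTeixeiradacosta2022, (3.11) with Takemura2017 Prop. 1.2] -/
def eulerGaugeQ (m₁ m₂ m₃ m₄ E z₂ : ℂ) : ℂ :=
  (4 * E * z₂ - z₂ - 1 - 4 * m₂ * (m₂ + 1) * z₂ + 2 * (m₁ + m₃ + m₄) - 2 * m₂
    + 2 * m₁ * m₂ - 2 * m₁ * m₃ - 2 * m₁ * m₄ + 2 * m₂ * m₃ + 2 * m₂ * m₄ - 2 * m₃ * m₄) / 4

/-- The Fuchs relation `γ + δ + ε = α + β + 1` holds identically in the Euler gauge.
[cite: CasalsTeixeiradacosta2022, (3.11) with Takemura2017 Prop. 1.2] -/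
theorem eulerGauge_fuchs (m₁ m₂ m₃ m₄ : ℂ) :
    eulerGaugeγ m₁ m₂ + eulerGaugeδ m₁ m₂ + eulerGaugeε m₃ m₄
      = eulerGaugeα m₂ m₃ + eulerGaugeβ m₂ m₄ + 1 := by
  unfold eulerGaugeγ eulerGaugeδ eulerGaugeε eulerGaugeα eulerGaugeβ; ring

/-- The normal-form invariant `Q = r − p′/2 − p²/4` of the Heun equation
`g″ + p g′ + r g = 0`, `p = γ/z + δ/(z−1) + ε/(z−z₂)`, `r = (αβ z + q)/(z(z−1)(z−z₂))` (Umetsu's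
sign): `y = exp(½∫p) g = z^{γ/2}(z−1)^{δ/2}(z−z₂)^{ε/2} g` satisfies `y″ + Q y = 0`.
[folklore] -/
def heunNormalFormQ (z₂ α β γ δ ε q : ℂ) (z : ℝ) : ℂ :=
  GeneralHeun.low α β q z / GeneralHeun.lead z₂ z
    - (-(γ / (z : ℂ) ^ 2) - δ / ((z : ℂ) - 1) ^ 2 - ε / ((z : ℂ) - z₂) ^ 2) / 2
    - (γ / (z : ℂ) + δ / ((z : ℂ) - 1) + ε / ((z : ℂ) - z₂)) ^ 2 / 4

/-- **(3.11) is the normal form of the Heun equation in the Euler gauge.** For real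
`z ∉ {0, 1}` and `z ≠ z₂`:
`C(z)/(z(z−1)(z−z₂)) = Q(z)` with `Q` the normal-form invariant of
`(γ,δ,ε;α,β;q) = (eulerGaugeγ, eulerGaugeδ, eulerGaugeε; eulerGaugeα, eulerGaugeβ; eulerGaugeQ)`.
(Equivalently: the local exponent differences of (3.11) are `m₁−m₂, m₁+m₂, m₃+m₄, m₃−m₄` at
`0, 1, z₂, ∞`.) [cite: CasalsTeixeiradacosta2022, (3.11); Takemura2017, Prop. 1.2 (normal form)] -/
theorem sqcdCoeff_eq_normalForm (m₁ m₂ m₃ m₄ E z₂ : ℂ) {z : ℝ} (hz0 : z ≠ 0) (hz1 : z ≠ 1)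
    (hz2 : (z : ℂ) ≠ z₂) :
    sqcdCoeff m₁ m₂ m₃ m₄ E z₂ z / GeneralHeun.lead z₂ z =
      heunNormalFormQ z₂ (eulerGaugeα m₂ m₃) (eulerGaugeβ m₂ m₄) (eulerGaugeγ m₁ m₂)
        (eulerGaugeδ m₁ m₂) (eulerGaugeε m₃ m₄) (eulerGaugeQ m₁ m₂ m₃ m₄ E z₂) z := by
  have h0 : (z : ℂ) ≠ 0 := by exact_mod_cast hz0
  have h1 : (z : ℂ) - 1 ≠ 0 := sub_ne_zero.mpr (by exact_mod_cast hz1)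
  have h2 : (z : ℂ) - z₂ ≠ 0 := sub_ne_zero.mpr hz2
  unfold sqcdCoeff heunNormalFormQ GeneralHeun.low GeneralHeun.lead eulerGaugeα eulerGaugeβ
    eulerGaugeγ eulerGaugeδ eulerGaugeε eulerGaugeQ
  field_simp
  ring

/-! ### The Euler map with `η = α` is the swap `m₂ ↔ m₃` -/

/-- `γ′ = γ − η + 1 = 1 − m₁ + m₃` (`= γ` with `m₂ ↔ m₃`).
[cite: CasalsTeixeiradacosta2022, Corollary 3.10 (iii); Takemura2017, Prop. 1.2] -/
theorem euler_swap_γ (m₁ m₂ m₃ : ℂ) :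
    GeneralHeun.eulerSrc (eulerGaugeγ m₁ m₂) (eulerGaugeα m₂ m₃) = eulerGaugeγ m₁ m₃ := by
  unfold GeneralHeun.eulerSrc eulerGaugeγ eulerGaugeα; ring

/-- `δ′ = 1 + m₁ + m₃`. [cite: CasalsTeixeiradacosta2022, Corollary 3.10 (iii); Takemura2017, Prop. 1.2] -/
theorem euler_swap_δ (m₁ m₂ m₃ : ℂ) :
    GeneralHeun.eulerSrc (eulerGaugeδ m₁ m₂) (eulerGaugeα m₂ m₃) = eulerGaugeδ m₁ m₃ := by
  unfold GeneralHeun.eulerSrc eulerGaugeδ eulerGaugeα; ring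

/-- `ε′ = 1 − m₂ − m₄`. [cite: CasalsTeixeiradacosta2022, Corollary 3.10 (iii); Takemura2017, Prop. 1.2] -/
theorem euler_swap_ε (m₂ m₃ m₄ : ℂ) :
    GeneralHeun.eulerSrc (eulerGaugeε m₃ m₄) (eulerGaugeα m₂ m₃) = eulerGaugeε m₂ m₄ := by
  unfold GeneralHeun.eulerSrc eulerGaugeε eulerGaugeα; ring

/-- `α′ = 2 − η = 1 + m₃ − m₂`. [cite: CasalsTeixeiradacosta2022, Corollary 3.10 (iii); Takemura2017, Prop. 1.2] -/
theorem euler_swap_α (m₂ m₃ : ℂ) :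
    GeneralHeun.eulerSrcα (eulerGaugeα m₂ m₃) = eulerGaugeα m₃ m₂ := by
  unfold GeneralHeun.eulerSrcα eulerGaugeα; ring

/-- `β′ = α + β − 2η + 1 = 1 + m₃ − m₄`. [cite: CasalsTeixeiradacosta2022, Corollary 3.10 (iii); Takemura2017, Prop. 1.2] -/
theorem euler_swap_β (m₂ m₃ m₄ : ℂ) :
    GeneralHeun.eulerSrcβ (eulerGaugeα m₂ m₃) (eulerGaugeβ m₂ m₄) (eulerGaugeα m₂ m₃)
      = eulerGaugeβ m₃ m₄ := by
  unfold GeneralHeun.eulerSrcβ eulerGaugeα eulerGaugeβ; ring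

/-- **The accessory parameter follows the swap** (the decisive identity; `E` fixed):
`q′ = q − (1−η)(ε + δz₂ + (γ−η)(z₂+1))` equals `eulerGaugeQ` with `m₂ ↔ m₃`.
[cite: CasalsTeixeiradacosta2022, Corollary 3.10 (iii); Takemura2017, Prop. 1.2] -/
theorem euler_swap_q (m₁ m₂ m₃ m₄ E z₂ : ℂ) :
    GeneralHeun.eulerSrcQ z₂ (eulerGaugeγ m₁ m₂) (eulerGaugeδ m₁ m₂) (eulerGaugeε m₃ m₄)
        (eulerGaugeQ m₁ m₂ m₃ m₄ E z₂) (eulerGaugeα m₂ m₃)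
      = eulerGaugeQ m₁ m₃ m₂ m₄ E z₂ := by
  unfold GeneralHeun.eulerSrcQ eulerGaugeγ eulerGaugeδ eulerGaugeε eulerGaugeQ eulerGaugeα; ring

/-- The Euler exponent is a root of the exponent pair at infinity: `(η−α)(η−β) = 0` with `η = α`.
[cite: Takemura2017, Prop. 1.2] -/
theorem euler_exponent_root (m₂ m₃ m₄ : ℂ) :
    (eulerGaugeα m₂ m₃ - eulerGaugeα m₂ m₃) * (eulerGaugeα m₂ m₃ - eulerGaugeβ m₂ m₄) = 0 := by
  ring

/-! ### The same data in the horizon quantities `s, η₀, η₁, η₂` -/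

/-- `γ = 1 − s + 2η₀`. [cite: CasalsTeixeiradacosta2022, Lemma 3.5 (3.15)] -/
theorem eulerGaugeγ_eta (s η₀ η₁ : ℂ) :
    eulerGaugeγ (sqcdM₁ s η₀ η₁) (sqcdM₂ η₀ η₁) = 1 - s + 2 * η₀ := by
  unfold eulerGaugeγ sqcdM₁ sqcdM₂; ring

/-- `δ = 1 + s − 2η₁`. [cite: CasalsTeixeiradacosta2022, Lemma 3.5 (3.15)] -/
theorem eulerGaugeδ_eta (s η₀ η₁ : ℂ) :
    eulerGaugeδ (sqcdM₁ s η₀ η₁) (sqcdM₂ η₀ η₁) = 1 + s - 2 * η₁ := by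
  unfold eulerGaugeδ sqcdM₁ sqcdM₂; ring

/-- `ε = 1 + s − 2η₂`. [cite: CasalsTeixeiradacosta2022, Lemma 3.5 (3.15)] -/
theorem eulerGaugeε_eta (s η₀ η₁ η₂ : ℂ) :
    eulerGaugeε (sqcdM₃ s η₀ η₁) (sqcdM₄ η₀ η₁ η₂) = 1 + s - 2 * η₂ := by
  unfold eulerGaugeε sqcdM₃ sqcdM₄; ring

/-- **The Euler exponent** `θ = η = α = 1 + s + 2η₀` (`η₀` = `etaCauchy`: the Cauchy-horizon
quantity `i(ω−mϖ₀)/(2κ₀)`). [cite: CasalsTeixeiradacosta2022, Lemma 3.5 (3.15); Takemura2017, Prop. 1.2] -/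
theorem eulerGaugeα_eta (s η₀ η₁ : ℂ) :
    eulerGaugeα (sqcdM₂ η₀ η₁) (sqcdM₃ s η₀ η₁) = 1 + s + 2 * η₀ := by
  unfold eulerGaugeα sqcdM₂ sqcdM₃; ring

/-- `β = 1 − 2η₁ − 2η₂`. [cite: CasalsTeixeiradacosta2022, Lemma 3.5 (3.15)] -/
theorem eulerGaugeβ_eta (η₀ η₁ η₂ : ℂ) :
    eulerGaugeβ (sqcdM₂ η₀ η₁) (sqcdM₄ η₀ η₁ η₂) = 1 - 2 * η₁ - 2 * η₂ := by
  unfold eulerGaugeβ sqcdM₂ sqcdM₄; ring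

/-- The kernel exponent for the direction original ⇒ swapped is `2 − θ = 1 − s − 2η₀`
(`= eulerGaugeα` of the swapped masses). [cite: CasalsTeixeiradacosta2022, Corollary 3.10 (iii); Takemura2017, remark after Prop. 1.2] -/
theorem eulerGaugeα_swap_eta (s η₀ η₁ : ℂ) :
    eulerGaugeα (sqcdM₃ s η₀ η₁) (sqcdM₂ η₀ η₁) = 1 - s - 2 * η₀ := by
  unfold eulerGaugeα sqcdM₂ sqcdM₃; ring

/-! ### Which Frobenius branch the mode conditions select (3.16), (3.26) -/

/-- (3.16): `−η₁ + (s−1)/2 = ½(m₁+m₂−1)` and the three companions.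
[cite: CasalsTeixeiradacosta2022, Lemma 3.5 (3.16)] -/
theorem exponent_identities (s η₀ η₁ η₂ : ℂ) :
    -η₁ + (s - 1) / 2 = (sqcdM₁ s η₀ η₁ + sqcdM₂ η₀ η₁ - 1) / 2 ∧
    -η₁ - (s + 1) / 2 = (sqcdM₃ s η₀ η₁ + sqcdM₂ η₀ η₁ - 1) / 2 ∧
    η₂ - (s + 1) / 2 = (sqcdM₃ s η₀ η₁ + sqcdM₄ η₀ η₁ η₂ - 1) / 2 ∧
    η₂ + (s - 1) / 2 = (sqcdM₁ s η₀ η₁ + sqcdM₄ η₀ η₁ η₂ - 1) / 2 := by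
  unfold sqcdM₁ sqcdM₂ sqcdM₃ sqcdM₄
  refine ⟨by ring, by ring, by ring, by ring⟩

/-- **Event horizon, original problem.** "Ingoing at `𝓗⁺`" (generic bullet:
`R(z)(z−1)^{−η₁+(s−1)/2}` smooth) means `y ~ (z−1)^{η₁−(s−1)/2}`; in the Euler gauge
`g = z^{−γ/2}(z−1)^{−δ/2}(z−z₂)^{−ε/2} y` this is the exponent `1 − δ = 2η₁ − s` (the non-analytic
branch, `δ = 1+s−2η₁`). [cite: CasalsTeixeiradacosta2022, Definition 3.3, Lemma 3.5 (3.16)] -/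
theorem branch_event (s η₀ η₁ : ℂ) :
    -(-η₁ + (s - 1) / 2) - eulerGaugeδ (sqcdM₁ s η₀ η₁) (sqcdM₂ η₀ η₁) / 2
      = 1 - eulerGaugeδ (sqcdM₁ s η₀ η₁) (sqcdM₂ η₀ η₁) := by
  unfold eulerGaugeδ sqcdM₁ sqcdM₂; ring

/-- **Cosmological horizon, original problem.** "Outgoing at `𝓗⁺_c`" (generic bullet:
`R(z)(z−z₂)^{η₂−(s+1)/2}` smooth) is, in the Euler gauge, the exponent `0`: the ANALYTIC branch at
`z₂`. [cite: CasalsTeixeiradacosta2022, Definition 3.3, Lemma 3.5 (3.16)] -/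
theorem branch_cosmo (s η₀ η₁ η₂ : ℂ) :
    -(η₂ - (s + 1) / 2) - eulerGaugeε (sqcdM₃ s η₀ η₁) (sqcdM₄ η₀ η₁ η₂) / 2 = 0 := by
  unfold eulerGaugeε sqcdM₃ sqcdM₄; ring

/-- **Event horizon, swapped problem (3.26).** `R̃(z)(z−1)^{−η₀−η₁−½}` smooth is the exponent
`1 − δ′ = 2η₀ + 2η₁` of the swapped gauge (`δ′ = 1+m₁+m₃`).
[cite: CasalsTeixeiradacosta2022, Corollary 3.10 (3.26)] -/
theorem branch_event_swap (s η₀ η₁ : ℂ) :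
    -(-η₀ - η₁ - 1 / 2) - eulerGaugeδ (sqcdM₁ s η₀ η₁) (sqcdM₃ s η₀ η₁) / 2
      = 1 - eulerGaugeδ (sqcdM₁ s η₀ η₁) (sqcdM₃ s η₀ η₁) := by
  unfold eulerGaugeδ sqcdM₁ sqcdM₃; ring

/-- **Cosmological horizon, swapped problem (3.26).** `R̃(z)(z−z₂)^{η₀+η₂−½}` smooth is the
exponent `0` of the swapped gauge (`ε′ = 1−m₂−m₄`): analytic at `z₂`.
[cite: CasalsTeixeiradacosta2022, Corollary 3.10 (3.26)] -/
theorem branch_cosmo_swap (η₀ η₁ η₂ : ℂ) :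
    -(η₀ + η₂ - 1 / 2) - eulerGaugeε (sqcdM₂ η₀ η₁) (sqcdM₄ η₀ η₁ η₂) / 2 = 0 := by
  unfold eulerGaugeε sqcdM₂ sqcdM₄; ring

/-! ### CTdC's (3.25) is (3.11) with `m₂ ↔ m₃` -/

/-- `z_∞ = (r₁−r₃)/(r₁−r₀)` of (3.14) with `r₃ = −(r₀+r₁+r₂)` (roots of `Δ`: `r₃ < 0 < r₀ < r₁ < r₂`,
i.e. `rNeg, rMinus, rPlus, rCosmo`). [cite: CasalsTeixeiradacosta2022, Lemma 3.5 (3.14)] -/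
def ctdcZinf (r₀ r₁ r₂ : ℝ) : ℝ := (r₁ + (r₀ + r₁ + r₂)) / (r₁ - r₀)

/-- `z₂ = z_∞ (r₂−r₀)/(r₂−r₃)`. [cite: CasalsTeixeiradacosta2022, Lemma 3.5 (3.14)] -/
def ctdcZ₂ (r₀ r₁ r₂ : ℝ) : ℝ := ctdcZinf r₀ r₁ r₂ * (r₂ - r₀) / (r₂ + (r₀ + r₁ + r₂))

/-- `E z₂` of (3.15b) (for a free symbol `z₂`), with the `λ̄`-block
`L²(λ̄−2Ξ²amω+a²Ξ²ω²)/((r₂−r₃)(r₁−r₀))` kept as one symbol `LT` and `r₃ = −(r₀+r₁+r₂)`: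
`E z₂ = ¼(1+z₂) + (η₀+η₁)²z₂ − (η₁²+η₀η₁+η₁η₂−η₀η₂) + LT + (r₀²+r₁²+2r₀r₂+2r₂(r₁+r₂))s²/(2(r₂−r₃)(r₁−r₀))`
`      − (r₁(r₂−r₃)+r₃(r₀+r₁))/((r₁−r₀)(r₂−r₃))`. [cite: CasalsTeixeiradacosta2022, Lemma 3.5 (3.15)] -/
def ctdcEz₂ (s η₀ η₁ η₂ LT z₂ : ℂ) (r₀ r₁ r₂ : ℝ) : ℂ :=
  (1 / 4 : ℂ) * (1 + z₂) + (η₀ + η₁) ^ 2 * z₂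
    - (η₁ ^ 2 + η₀ * η₁ + η₁ * η₂ - η₀ * η₂) + LT
    + (((r₀ : ℂ) ^ 2 + (r₁ : ℂ) ^ 2 + 2 * r₀ * r₂ + 2 * r₂ * ((r₁ : ℂ) + r₂)) /
        (2 * ((r₂ : ℂ) + (r₀ + r₁ + r₂)) * ((r₁ : ℂ) - r₀))) * s ^ 2
    - ((r₁ : ℂ) * ((r₂ : ℂ) + (r₀ + r₁ + r₂)) - ((r₀ : ℂ) + r₁ + r₂) * ((r₀ : ℂ) + r₁)) /
        (((r₁ : ℂ) - r₀) * ((r₂ : ℂ) + (r₀ + r₁ + r₂)))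

/-- The `y`-coefficient `C̃(z)` of CTdC's transformed ODE (3.25), `z(z−1)(z−z₂)R̃″ + C̃ R̃ = 0`
(for a free symbol `z₂`; `LT` the `λ̄`-block; `r₃ = −(r₀+r₁+r₂)`).
[cite: CasalsTeixeiradacosta2022, Corollary 3.10 (3.25)] -/
def ctdcTildeCoeff (s η₀ η₁ η₂ LT z₂ : ℂ) (r₀ r₁ r₂ : ℝ) (z : ℝ) : ℂ :=
  LT
  + (s ^ 2 * ((r₁ : ℂ) + r₂) ^ 2 *
        ((z : ℂ) - ((r₂ : ℂ) - r₀) * ((r₁ : ℂ) + (r₀ + r₁ + r₂)) / ((r₁ : ℂ) + r₂) ^ 2)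
      + (1 / 2 : ℂ) * z * ((r₀ : ℂ) + r₁) ^ 2)
      / (((r₁ : ℂ) - r₀) * ((r₂ : ℂ) + (r₀ + r₁ + r₂)) * z)
  + (z : ℂ) / (z₂ - z) *
      (((z : ℂ) - 1) * η₂ ^ 2 + 2 * (z₂ - 1) * η₀ * η₂
        + (z₂ - 1) ^ 2 / ((z : ℂ) - 1) * η₀ ^ 2 - (1 / 4 : ℂ) * ((z : ℂ) - 1))
  + (z : ℂ) / ((z : ℂ) - 1) *
      (2 * (z₂ - 1) * η₀ * η₁ + (z₂ - z) * η₁ ^ 2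
        - (z₂ - z) / (4 * (z : ℂ) ^ 2) - 2 * ((z : ℂ) - 1) * η₁ * η₂)

/-- (3.25) versus (3.11) with `m₂ ↔ m₃` for a FREE symbol `z₂`: they differ exactly by
`s²(z₂ − Z)/z` with `Z = (r₁−r₃)(r₂−r₀)/((r₁−r₀)(r₂−r₃))` the value (3.14) of `z₂` — so they agree
precisely when `z₂` is CTdC's (next theorem). [cite: CasalsTeixeiradacosta2022, Corollary 3.10 (3.25) with Lemma 3.5] -/
theorem ctdcTilde_eq_sqcd_swap_add (s η₀ η₁ η₂ LT z₂ : ℂ) {r₀ r₁ r₂ z : ℝ}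
    (h10 : (r₁ : ℂ) - r₀ ≠ 0) (h23 : (r₂ : ℂ) + (r₀ + r₁ + r₂) ≠ 0) (h12 : (r₁ : ℂ) + r₂ ≠ 0)
    (hz0 : (z : ℂ) ≠ 0) (hz1 : (z : ℂ) - 1 ≠ 0) (hz2 : z₂ - (z : ℂ) ≠ 0) (hz₂ : z₂ ≠ 0) :
    ctdcTildeCoeff s η₀ η₁ η₂ LT z₂ r₀ r₁ r₂ z =
      sqcdCoeff (sqcdM₁ s η₀ η₁) (sqcdM₃ s η₀ η₁) (sqcdM₂ η₀ η₁) (sqcdM₄ η₀ η₁ η₂)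
          (ctdcEz₂ s η₀ η₁ η₂ LT z₂ r₀ r₁ r₂ / z₂) z₂ z
        + s ^ 2 * (z₂ - ((r₁ : ℂ) + (r₀ + r₁ + r₂)) * ((r₂ : ℂ) - r₀) /
            (((r₁ : ℂ) - r₀) * ((r₂ : ℂ) + (r₀ + r₁ + r₂)))) / (z : ℂ) := by
  have hz2' : (z : ℂ) - z₂ ≠ 0 := fun h => hz2 (by linear_combination -h)
  unfold ctdcTildeCoeff sqcdCoeff ctdcEz₂ sqcdM₁ sqcdM₂ sqcdM₃ sqcdM₄
  field_simp
  ring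

/-- **(3.25) is (3.11) with `m₂ ↔ m₃`** — masses (3.15a), `E` from (3.15b), `z₂` from (3.14) —
as an identity of rational functions of `z` with `s, η₀, η₁, η₂, LT, r₀, r₁, r₂` free
(denominators nonzero). [cite: CasalsTeixeiradacosta2022, Corollary 3.10 (3.25) with Lemma 3.5] -/
theorem ctdcTilde_eq_sqcd_swap (s η₀ η₁ η₂ LT : ℂ) {r₀ r₁ r₂ z : ℝ}
    (h10 : (r₁ : ℂ) - r₀ ≠ 0) (h23 : (r₂ : ℂ) + (r₀ + r₁ + r₂) ≠ 0) (h12 : (r₁ : ℂ) + r₂ ≠ 0)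
    (hz0 : (z : ℂ) ≠ 0) (hz1 : (z : ℂ) - 1 ≠ 0) (hz2 : (ctdcZ₂ r₀ r₁ r₂ : ℂ) - (z : ℂ) ≠ 0)
    (hz₂ : (ctdcZ₂ r₀ r₁ r₂ : ℂ) ≠ 0) :
    ctdcTildeCoeff s η₀ η₁ η₂ LT (ctdcZ₂ r₀ r₁ r₂) r₀ r₁ r₂ z =
      sqcdCoeff (sqcdM₁ s η₀ η₁) (sqcdM₃ s η₀ η₁) (sqcdM₂ η₀ η₁) (sqcdM₄ η₀ η₁ η₂)
        (ctdcEz₂ s η₀ η₁ η₂ LT (ctdcZ₂ r₀ r₁ r₂) r₀ r₁ r₂ / (ctdcZ₂ r₀ r₁ r₂ : ℂ))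
        (ctdcZ₂ r₀ r₁ r₂) z := by
  rw [ctdcTilde_eq_sqcd_swap_add s η₀ η₁ η₂ LT _ h10 h23 h12 hz0 hz1 hz2 hz₂]
  have hZ : (ctdcZ₂ r₀ r₁ r₂ : ℂ) - ((r₁ : ℂ) + (r₀ + r₁ + r₂)) * ((r₂ : ℂ) - r₀) /
      (((r₁ : ℂ) - r₀) * ((r₂ : ℂ) + (r₀ + r₁ + r₂))) = 0 := by
    unfold ctdcZ₂ ctdcZinf
    push_cast
    field_simp
    ring
  rw [hZ]
  simp

end Literature.Geometry.Lorentzian.KerrDeSitter
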